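import Mathlib.CategoryTheory.Abelian.GrothendieckCategory.EnoughInjectives
import Mathlib.CategoryTheory.Preadditive.Injective.LiftingProperties
import Mathlib.Algebra.Category.Grp.Ulift
import Mathlib.Algebra.Group.Shrink
import Mathlib.CategoryTheory.Sites.LocallyBijective
import Mathlib.CategoryTheory.Sites.Localization
import Literature.AlgebraicGeometry.Motives.EtaleToProetLocalGlobal
import HarnessLib

/-!
# The change of coefficient universe `ulift : Shv(X_ét, Ab.{u}) → Shv(X_ét, Ab.{u+1})` preserves
# injective sheaves; Bhatt–Scholze Cor. 5.1.6 and Prop. 5.6.2 from the local claim alone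

Mathlib's `Scheme.EllAdicCohomology` lives on `X.ProEt` with coefficients in `Ab.{u+1}`, while the
étale cohomology of the tree (`Sheaf.H` of `Ab.{u}`-valued sheaves on `X.Etale`, `HasExt.{u}` via
the affine étale site) has coefficients in `Ab.{u}`; every comparison between the two
(`nonempty_addEquiv_sheafH_etaleToProetPullback`, Bhatt–Scholze Cor. 5.1.6 as vendored) therefore
passes through the change of coefficient universe
`ulift = uliftEtSheaf X = sheafCompose _ uliftFunctor : Shv(X_ét, Ab.{u}) → Shv(X_ét, Ab.{u+1})`,
and the dimension shifting of `EtaleToProetExt.lean` / `EtaleToProetLocalGlobal.lean` needs that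
**`ulift` preserves injective objects** — the hypothesis `hL` of
`subsingleton_sheafH_etaleToProetPullbackULift_of_local`. This file proves it
(`injective_uliftEtSheaf_obj`) and removes `hL`:

* `shrinkPresheaf`, `shrinkEtSheaf`, `uliftShrinkEtSheafIso` — an objectwise `u`-small
  `Ab.{u+1}`-valued étale sheaf is `ulift` of an `Ab.{u}`-valued one (Mathlib `Shrink`; the sheaf
  condition is reflected by the fully faithful `uliftFunctor`);
* `sheafifyULiftIso` — `(P ⋙ ulift)^# ≅ ulift (P^#)`: the lift of `P → P^#` is locally bijective
  (the étale site is `WEqualsLocallyBijective` in both universes), hence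
  `freeYonedaSheafULiftIso`: `ℤ[h_V]` with big coefficients is `ulift` of `ℤ[h_V]`;
* `isSeparator_ulift_freeZAffineSum` — `ulift (⊕_k ℤ[h_{c_k}])` is a separator of
  `Shv(X_ét, Ab.{u+1})`, `c_k` running over a `u`-small model of the affine étale `X`-schemes
  (Mathlib `X.AffineEtale` is essentially `u`-small): two maps agreeing after all
  `ℤ[h_{c_k}] → F` agree on sections over the `c_k`, hence over every affine (isomorphic to some
  `c_k`), hence everywhere (affine opens cover, sheaves are separated: `hom_ext_of_freeYoneda`);
* `injective_uliftEtSheaf_obj` — **`ulift I` is injective for `I` injective**: by Baer's criterion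
  in the Grothendieck abelian `Shv(X_ét, Ab.{u+1})` (Mathlib
  `IsGrothendieckAbelian.generatingMonomorphisms_rlp`, `injective_iff_rlp_monomorphisms_zero`) it
  suffices to extend maps to `ulift I` along subobjects `A ↪ ulift G₀` of that separator; `A` is
  objectwise small, so `A ≅ ulift A₀` and inclusion and map come from `Shv(X_ét, Ab.{u})` (`ulift`
  fully faithful), where `I` is injective;
* `subsingleton_sheafH_etaleToProetPullbackULift_of_local'`,
  `nonempty_addEquiv_sheafH_etaleToProetPullback_of_local'`,
  `ellAdicCohomology_limOneSequence_of_local'` — **Cor. 5.1.6 (`hc`, the comparison) and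
  Prop. 5.6.2 (the `lim¹` sequence) from the printed local claim `hloc` alone**:
  "`Hᵖ(U, ν*I) = 0` for `I ∈ Ab(X_ét)` injective, `p > 0`", on the affine étale `U`
  (`IsLocallyAcyclicOnAffineEtale`). That claim — the Čech computation over cofinal ind-étale
  covers (Thm. 2.3.4, [SGA4, V.4.3]) — is now the only unproved input of
  `nonempty_addEquiv_sheafH_etaleToProetPullback` and `ellAdicCohomology_limOneSequence`.

## References

* B. Bhatt, P. Scholze, *The pro-étale topology for schemes*, Astérisque 369 (2015)
  (arXiv:1309.1198, held; arXiv p. 29): Cor. 5.1.6 and its proof, Prop. 5.6.2, Remark 4.1.2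
  (cardinal bounds / universes). [BhattScholze2015]
* Baer's criterion in Grothendieck abelian categories: Mathlib
  `CategoryTheory.Abelian.GrothendieckCategory.EnoughInjectives` (Grothendieck, *Tôhoku* §1.10);
  folklore.

## Design notes

* Only theorems and definitions with bodies; no named facts (D-0026). Instances are declared only
  on this file's own objects (`hasCoproduct_freeZAffine`); the Grothendieck-abelian structure of
  `Shv(X_ét, Ab.{u+1})` (as Mathlib's instance for `X.ProEt`, via `EssentiallySmall.{u+1} X.Etale`)
  is a theorem used as a local instance.
* The big-coefficient `ℤ` is taken as `zAb' = uliftFunctor.obj (ULift ℤ)` so that the free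
  presheaves in the two universes differ by `ulift` summand-wise on the nose
  (`freeYonedaULiftIso` is then `PreservesCoproduct.iso`).
* Mathlib searches: `GrpCat.shrinkFunctor` (groups only; the abelian presheaf version is
  `shrinkPresheaf` here), `Shrink.addEquiv`, `Presheaf.isSheaf_of_isSheaf_comp`,
  `Sheaf.isLocallyBijective_iff_isIso`, `GrothendieckTopology.W_toSheafify`,
  `Sheaf.freeYoneda(HomEquiv)`, `equivSmallModel`, `Scheme.AffineEtale.Spec`,
  `IsGrothendieckAbelian.generatingMonomorphisms_rlp`, `HasLiftingProperty.of_arrow_iso_left`;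
  no statement that `sheafCompose _ uliftFunctor` preserves injectives or commutes with
  sheafification on a large site exists in Mathlib. Nothing restated.
-/

universe v₁ u₁ u

open CategoryTheory Limits Opposite AlgebraicGeometry ZeroObject

noncomputable section

namespace Literature.AlgebraicGeometry.Motives

/-! ### Shrinking an objectwise small presheaf of abelian groups -/

section Shrink

variable {C : Type u₁} [Category.{v₁} C]

/-- An `Ab.{u+1}`-valued presheaf all of whose values are `u`-small, shrunk to an `Ab.{u}`-valued
presheaf (Mathlib `Shrink`, `Shrink.addEquiv`; cf. `GrpCat.shrinkFunctor`). [folklore] -/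
def shrinkPresheaf (P : Cᵒᵖ ⥤ AddCommGrpCat.{u + 1}) [∀ V, Small.{u} (P.obj V)] :
    Cᵒᵖ ⥤ AddCommGrpCat.{u} where
  obj V := AddCommGrpCat.of (Shrink.{u} (P.obj V))
  map f := AddCommGrpCat.ofHom
    (Shrink.addEquiv.{u}.symm.toAddMonoidHom.comp
      ((P.map f).hom.comp Shrink.addEquiv.{u}.toAddMonoidHom))
  map_id V := by
    ext x
    simp
  map_comp f g := by
    ext x
    simp

/-- Lifting the shrunk presheaf back to `Ab.{u+1}` recovers the presheaf. [folklore] -/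
def shrinkPresheafCompULiftIso (P : Cᵒᵖ ⥤ AddCommGrpCat.{u + 1}) [∀ V, Small.{u} (P.obj V)] :
    shrinkPresheaf P ⋙ AddCommGrpCat.uliftFunctor.{u + 1, u} ≅ P :=
  NatIso.ofComponents (fun V => (AddEquiv.ulift.trans Shrink.addEquiv.{u}).toAddCommGrpIso)
    (by
      intro V W f
      ext x
      change Shrink.addEquiv.{u} (Shrink.addEquiv.{u}.symm (P.map f (Shrink.addEquiv.{u} x.down))) =
        P.map f (Shrink.addEquiv.{u} x.down)
      exact AddEquiv.apply_symm_apply _ _)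

end Shrink

/-! ### Objectwise small étale sheaves come from `Shv(X_ét, Ab.{u})` -/

section EssImage

variable (X : Scheme.{u})

/-- An objectwise `u`-small `Ab.{u+1}`-valued étale sheaf, shrunk to an `Ab.{u}`-valued étale
sheaf: the shrunk presheaf is a sheaf because its lift to `Ab.{u+1}` is isomorphic to the given
sheaf and `uliftFunctor` (fully faithful) reflects the limit condition. [folklore] -/
def shrinkEtSheaf (F : Sheaf X.smallEtaleTopology AddCommGrpCat.{u + 1})
    [∀ V, Small.{u} (F.obj.obj V)] : Sheaf X.smallEtaleTopology AddCommGrpCat.{u} :=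
  ⟨shrinkPresheaf F.obj, Presheaf.isSheaf_of_isSheaf_comp X.smallEtaleTopology _
    AddCommGrpCat.uliftFunctor.{u + 1, u}
    ((Presheaf.isSheaf_of_iso_iff (shrinkPresheafCompULiftIso F.obj)).2 F.property)⟩

/-- **The essential image of `ulift` is the objectwise small sheaves**: an objectwise `u`-small
`F ∈ Shv(X_ét, Ab.{u+1})` is `ulift` of its shrinking. [folklore] -/
def uliftShrinkEtSheafIso (F : Sheaf X.smallEtaleTopology AddCommGrpCat.{u + 1})
    [∀ V, Small.{u} (F.obj.obj V)] : (uliftEtSheaf X).obj (shrinkEtSheaf X F) ≅ F :=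
  ObjectProperty.isoMk _ (shrinkPresheafCompULiftIso F.obj)

end EssImage

/-! ### Sheafification commutes with `ulift` -/

section Sheafify

variable (X : Scheme.{u})

/-- Local injectivity is insensitive to lifting the coefficient universe (the equalizer sieves are
the same). [folklore] -/
theorem isLocallyInjective_whiskerRight_uliftFunctor {P Q : (X.Etale)ᵒᵖ ⥤ AddCommGrpCat.{u}}
    (φ : P ⟶ Q) [Presheaf.IsLocallyInjective X.smallEtaleTopology φ] :
    Presheaf.IsLocallyInjective X.smallEtaleTopology
      (Functor.whiskerRight φ AddCommGrpCat.uliftFunctor.{u + 1, u}) where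
  equalizerSieve_mem {V} x y h := by
    refine GrothendieckTopology.superset_covering _ ?_
      (Presheaf.equalizerSieve_mem X.smallEtaleTopology φ x.down y.down (congrArg ULift.down h))
    intro W f hf
    exact congrArg ULift.up hf

/-- **`(P ⋙ ulift)^# ≅ ulift (P^#)`** for an `Ab.{u}`-valued étale presheaf `P`: the lift of the
sheafification map `P → P^#` is locally injective and locally surjective (as `P → P^#` is, the
étale site satisfying `WEqualsLocallyBijective` in both coefficient universes), hence induces an
isomorphism from the sheafification of `P ⋙ ulift` onto the sheaf `ulift (P^#)`. [folklore] -/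
theorem isIso_sheafifyLift_whiskerRight_toSheafify (P : (X.Etale)ᵒᵖ ⥤ AddCommGrpCat.{u}) :
    IsIso (ObjectProperty.homMk (sheafifyLift X.smallEtaleTopology
      (Functor.whiskerRight (toSheafify X.smallEtaleTopology P) AddCommGrpCat.uliftFunctor.{u + 1, u})
      ((uliftEtSheaf X).obj ((presheafToSheaf X.smallEtaleTopology AddCommGrpCat.{u}).obj P)).property) :
      (presheafToSheaf X.smallEtaleTopology AddCommGrpCat.{u + 1}).obj
          (P ⋙ AddCommGrpCat.uliftFunctor.{u + 1, u}) ⟶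
        (uliftEtSheaf X).obj ((presheafToSheaf X.smallEtaleTopology AddCommGrpCat.{u}).obj P)) := by
  let η : P ⋙ AddCommGrpCat.uliftFunctor.{u + 1, u} ⟶
      ((uliftEtSheaf X).obj ((presheafToSheaf X.smallEtaleTopology AddCommGrpCat.{u}).obj P)).obj :=
    Functor.whiskerRight (toSheafify X.smallEtaleTopology P) AddCommGrpCat.uliftFunctor.{u + 1, u}
  let θ : (presheafToSheaf X.smallEtaleTopology AddCommGrpCat.{u + 1}).obj
        (P ⋙ AddCommGrpCat.uliftFunctor.{u + 1, u}) ⟶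
      (uliftEtSheaf X).obj ((presheafToSheaf X.smallEtaleTopology AddCommGrpCat.{u}).obj P) :=
    ObjectProperty.homMk (sheafifyLift X.smallEtaleTopology η
      ((uliftEtSheaf X).obj ((presheafToSheaf X.smallEtaleTopology AddCommGrpCat.{u}).obj P)).property)
  have fac : toSheafify X.smallEtaleTopology _ ≫ θ.hom = η :=
    toSheafify_sheafifyLift X.smallEtaleTopology _ _
  haveI : Presheaf.IsLocallySurjective X.smallEtaleTopology η :=
    isLocallySurjective_whiskerRight_uliftFunctor X _
  haveI : Presheaf.IsLocallyInjective X.smallEtaleTopology η :=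
    isLocallyInjective_whiskerRight_uliftFunctor X _
  haveI : Sheaf.IsLocallySurjective θ :=
    Presheaf.isLocallySurjective_of_isLocallySurjective_fac _ fac
  haveI : Sheaf.IsLocallyInjective θ :=
    Presheaf.isLocallyInjective_of_isLocallyInjective_of_isLocallySurjective_fac _ η fac
  exact (Sheaf.isLocallyBijective_iff_isIso θ).1 ⟨inferInstance, inferInstance⟩

/-- The isomorphism `(P ⋙ ulift)^# ≅ ulift (P^#)`. [folklore] -/
def sheafifyULiftIso (P : (X.Etale)ᵒᵖ ⥤ AddCommGrpCat.{u}) :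
    (presheafToSheaf X.smallEtaleTopology AddCommGrpCat.{u + 1}).obj
        (P ⋙ AddCommGrpCat.uliftFunctor.{u + 1, u}) ≅
      (uliftEtSheaf X).obj ((presheafToSheaf X.smallEtaleTopology AddCommGrpCat.{u}).obj P) :=
  haveI := isIso_sheafifyLift_whiskerRight_toSheafify X P
  asIso (ObjectProperty.homMk (sheafifyLift X.smallEtaleTopology
      (Functor.whiskerRight (toSheafify X.smallEtaleTopology P) AddCommGrpCat.uliftFunctor.{u + 1, u})
      ((uliftEtSheaf X).obj ((presheafToSheaf X.smallEtaleTopology AddCommGrpCat.{u}).obj P)).property))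

end Sheafify

/-! ### The free abelian sheaves `ℤ[h_V]` in the two coefficient universes -/

section FreeZ

variable (X : Scheme.{u})

/-- `ℤ` as an object of `Ab.{u}`. [folklore] -/
abbrev zAb : AddCommGrpCat.{u} := AddCommGrpCat.of (ULift.{u} ℤ)

/-- `ℤ` as an object of `Ab.{u+1}`, in the form `ulift ℤ` (so that the free presheaves in the two
coefficient universes differ by `ulift` on the nose on summands). [folklore] -/
abbrev zAb' : AddCommGrpCat.{u + 1} := AddCommGrpCat.uliftFunctor.{u + 1, u}.obj zAb.{u}

/-- The free presheaves `V' ↦ ⊕_{V' → V} ℤ` in the two coefficient universes differ by `ulift`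
(`uliftFunctor` preserves coproducts). [folklore] -/
def freeYonedaULiftIso (V : X.Etale) :
    Presheaf.freeYoneda V zAb'.{u} ≅
      Presheaf.freeYoneda V zAb.{u} ⋙ AddCommGrpCat.uliftFunctor.{u + 1, u} :=
  NatIso.ofComponents
    (fun Y => (PreservesCoproduct.iso AddCommGrpCat.uliftFunctor.{u + 1, u} _).symm)
    (by
      intro Y Y' g
      apply Sigma.hom_ext
      intro i
      simp only [Iso.symm_hom, PreservesCoproduct.inv_hom, Presheaf.freeYoneda_map,
        Functor.comp_map]
      erw [Sigma.ι_comp_map'_assoc, Category.id_comp, ι_comp_sigmaComparison,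
        ι_comp_sigmaComparison_assoc, ← CategoryTheory.Functor.map_comp, Sigma.ι_comp_map',
        Category.id_comp]
      rfl)

/-- **`ℤ[h_V]` with coefficients in `Ab.{u+1}` is `ulift` of `ℤ[h_V]` with coefficients in
`Ab.{u}`** (sheafification commutes with `ulift`, `sheafifyULiftIso`). [folklore] -/
def freeYonedaSheafULiftIso (V : X.Etale) :
    Sheaf.freeYoneda X.smallEtaleTopology V zAb'.{u} ≅
      (uliftEtSheaf X).obj (Sheaf.freeYoneda X.smallEtaleTopology V zAb.{u}) :=
  (presheafToSheaf X.smallEtaleTopology AddCommGrpCat.{u + 1}).mapIso (freeYonedaULiftIso X V) ≪≫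
    sheafifyULiftIso X _

/-- Naturality in `F` of Mathlib's `Sheaf.freeYonedaHomEquiv : (ℤ[h_V] ⊗ M ⟶ F) ≃ (M ⟶ F(V))`.
[folklore] -/
theorem freeYonedaHomEquiv_comp {C : Type u₁} [Category.{v₁} C] {J : GrothendieckTopology C}
    {A : Type*} [Category A] [HasCoproducts.{v₁} A] [HasWeakSheafify J A] {V : C} {M : A}
    {F G : Sheaf J A} (a : Sheaf.freeYoneda J V M ⟶ F) (f : F ⟶ G) :
    Sheaf.freeYonedaHomEquiv (a ≫ f) = Sheaf.freeYonedaHomEquiv a ≫ f.hom.app (op V) := by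
  have h1 : (sheafificationAdjunction J A).homEquiv _ _ (a ≫ f) =
      (sheafificationAdjunction J A).homEquiv _ _ a ≫ f.hom :=
    Adjunction.homEquiv_naturality_right _ _ _
  change Presheaf.freeYonedaHomEquiv (F := G.obj) ((sheafificationAdjunction J A).homEquiv _ _
      (a ≫ f)) = Presheaf.freeYonedaHomEquiv (F := F.obj)
        ((sheafificationAdjunction J A).homEquiv _ _ a) ≫ f.hom.app (op V)
  rw [h1, Presheaf.freeYonedaHomEquiv_comp]
  rfl

end FreeZ

/-! ### An objectwise small separator of `Shv(X_ét, Ab.{u+1})` -/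

section Separator

variable (X : Scheme.{u})

/-- A `u`-small indexing of the affine étale `X`-schemes up to isomorphism (the small model of
Mathlib's essentially small affine étale site `X.AffineEtale`). [folklore] -/
def affineEtaleModel (k : SmallModel.{u} X.AffineEtale) : X.Etale :=
  (Scheme.AffineEtale.Spec X).obj ((equivSmallModel.{u} X.AffineEtale).inverse.obj k)

/-- Every affine `W ∈ X_ét` is isomorphic to a member of the small family. [folklore] -/
def isoAffineEtaleModel (W : X.Etale) [IsAffine W.left] :
    Σ k : SmallModel.{u} X.AffineEtale, W ≅ affineEtaleModel X k :=
  letI : Etale (W.left.isoSpec.inv ≫ W.hom) := inferInstance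
  let a : X.AffineEtale := Scheme.AffineEtale.mk (W.left.isoSpec.inv ≫ W.hom)
  ⟨(equivSmallModel.{u} X.AffineEtale).functor.obj a,
    MorphismProperty.Over.isoMk W.left.isoSpec
        (show W.left.isoSpec.hom ≫ (W.left.isoSpec.inv ≫ W.hom) = W.hom from
          W.left.isoSpec.hom_inv_id_assoc W.hom) ≪≫
      (Scheme.AffineEtale.Spec X).mapIso ((equivSmallModel.{u} X.AffineEtale).unitIso.app a)⟩

/-- `ℤ[h_{c_k}]` with coefficients in `Ab.{u}`, for the small family `c_k` of affine étale
`X`-schemes. [folklore] -/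
abbrev freeZAffine (k : SmallModel.{u} X.AffineEtale) : Sheaf X.smallEtaleTopology AddCommGrpCat.{u} :=
  Sheaf.freeYoneda X.smallEtaleTopology (affineEtaleModel X k) zAb.{u}

set_option synthInstance.maxHeartbeats 200000 in
/-- The coproduct `⊕_k ℤ[h_{c_k}]` exists in the Grothendieck abelian category
`Shv(X_ét, Ab.{u})` (the index type is `u`-small). [folklore] -/
instance hasCoproduct_freeZAffine : HasCoproduct (freeZAffine X) :=
  ((IsGrothendieckAbelian.hasColimits
    (Sheaf X.smallEtaleTopology AddCommGrpCat.{u})).has_colimits_of_shape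
      (Discrete (SmallModel.{u} X.AffineEtale))).has_colimit _

/-- `G₀ = ⊕_k ℤ[h_{c_k}] ∈ Shv(X_ét, Ab.{u})`. [folklore] -/
abbrev freeZAffineSum : Sheaf X.smallEtaleTopology AddCommGrpCat.{u} :=
  ∐ freeZAffine X

/-- The retraction `G₀ → ℤ[h_{c_k}]` of the `k`-th coprojection. [folklore] -/
def freeZAffineSumRetraction (k : SmallModel.{u} X.AffineEtale) :
    freeZAffineSum X ⟶ freeZAffine X k := by
  classical
  exact Sigma.desc fun l => if h : l = k then eqToHom (by rw [h]) else 0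

/-- The `k`-th coprojection followed by the retraction is the identity. [folklore] -/
theorem ι_freeZAffineSumRetraction (k : SmallModel.{u} X.AffineEtale) :
    Sigma.ι (freeZAffine X) k ≫ freeZAffineSumRetraction X k = 𝟙 _ := by
  rw [freeZAffineSumRetraction, Sigma.ι_desc, dif_pos rfl, eqToHom_refl]

variable {X}

/-- Two morphisms of `Ab.{u+1}`-valued étale sheaves which agree after every map from a
`ℤ[h_{c_k}]` (coefficients `Ab.{u+1}`) agree on the sections over every `c_k`. [folklore] -/
theorem app_eq_of_freeYoneda {F G : Sheaf X.smallEtaleTopology AddCommGrpCat.{u + 1}} (f g : F ⟶ G)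
    (k : SmallModel.{u} X.AffineEtale)
    (h : ∀ a : Sheaf.freeYoneda X.smallEtaleTopology (affineEtaleModel X k) zAb'.{u} ⟶ F,
      a ≫ f = a ≫ g) :
    f.hom.app (op (affineEtaleModel X k)) = g.hom.app (op (affineEtaleModel X k)) := by
  ext x
  let sx : zAb'.{u} ⟶ F.obj.obj (op (affineEtaleModel X k)) :=
    AddCommGrpCat.ofHom (AddMonoidHom.mk' (fun n => n.down.down • x) fun a b => add_zsmul x _ _)
  have hsx : sx (ULift.up (ULift.up 1)) = x := one_zsmul x
  have h' := congrArg Sheaf.freeYonedaHomEquiv (h (Sheaf.freeYonedaHomEquiv.symm sx))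
  rw [freeYonedaHomEquiv_comp, freeYonedaHomEquiv_comp, Equiv.apply_symm_apply] at h'
  have h'' := congrArg (fun φ : zAb'.{u} ⟶ _ => φ (ULift.up (ULift.up 1))) h'
  simpa only [AddCommGrpCat.hom_comp, AddMonoidHom.coe_comp, Function.comp_apply, hsx] using h''

/-- … hence on the sections over every affine `W ∈ X_ét` … [folklore] -/
theorem app_eq_of_freeYoneda_of_isAffine {F G : Sheaf X.smallEtaleTopology AddCommGrpCat.{u + 1}}
    (f g : F ⟶ G)
    (h : ∀ (k : SmallModel.{u} X.AffineEtale)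
      (a : Sheaf.freeYoneda X.smallEtaleTopology (affineEtaleModel X k) zAb'.{u} ⟶ F),
      a ≫ f = a ≫ g)
    (W : X.Etale) [IsAffine W.left] : f.hom.app (op W) = g.hom.app (op W) := by
  obtain ⟨k, φ⟩ := isoAffineEtaleModel X W
  haveI : IsIso (G.obj.map φ.inv.op) := Functor.map_isIso _ _
  rw [← cancel_mono (G.obj.map φ.inv.op), ← f.hom.naturality, ← g.hom.naturality,
    app_eq_of_freeYoneda f g k (h k)]

/-- … hence everywhere: **the `ℤ[h_{c_k}]` (coefficients `Ab.{u+1}`) form a separating family of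
`Shv(X_ét, Ab.{u+1})`** (an étale `X`-scheme is covered by its affine opens and sheaves are
separated). [folklore] -/
theorem hom_ext_of_freeYoneda {F G : Sheaf X.smallEtaleTopology AddCommGrpCat.{u + 1}} (f g : F ⟶ G)
    (h : ∀ (k : SmallModel.{u} X.AffineEtale)
      (a : Sheaf.freeYoneda X.smallEtaleTopology (affineEtaleModel X k) zAb'.{u} ⟶ F),
      a ≫ f = a ≫ g) : f = g := by
  apply (sheafToPresheaf _ _).map_injective
  ext V : 2
  let 𝒰 := V.unop.left.affineCover
  refine G.property.hom_ext_ofArrows (fun i => etOfOpensι V.unop (𝒰.f i).opensRange)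
    (ofArrows_etOfOpensι_mem V.unop (fun i => (𝒰.f i).opensRange) fun x => ?_) fun i => ?_
  · obtain ⟨i, y, hy⟩ := 𝒰.exists_eq x
    exact ⟨i, ⟨y, hy⟩⟩
  · haveI : IsAffine (etOfOpens V.unop (𝒰.f i).opensRange).left := isAffineOpen_opensRange (𝒰.f i)
    change f.hom.app V ≫ G.obj.map (etOfOpensι V.unop (𝒰.f i).opensRange).op =
      g.hom.app V ≫ G.obj.map (etOfOpensι V.unop (𝒰.f i).opensRange).op
    rw [← f.hom.naturality, ← g.hom.naturality,
      app_eq_of_freeYoneda_of_isAffine f g h (etOfOpens V.unop (𝒰.f i).opensRange)]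

variable (X)

/-- **`ulift G₀ = ulift (⊕_k ℤ[h_{c_k}])` is a separator of `Shv(X_ét, Ab.{u+1})`**: a map from
`ℤ[h_{c_k}]' ≅ ulift ℤ[h_{c_k}]` (`freeYonedaSheafULiftIso`) extends to `ulift G₀` along the
retraction of the coprojection. [folklore] -/
theorem isSeparator_ulift_freeZAffineSum : IsSeparator ((uliftEtSheaf X).obj (freeZAffineSum X)) := by
  rw [isSeparator_def]
  intro F G f g hfg
  refine hom_ext_of_freeYoneda f g fun k a => ?_
  have h := hfg ((uliftEtSheaf X).map (freeZAffineSumRetraction X k) ≫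
    (freeYonedaSheafULiftIso X (affineEtaleModel X k)).inv ≫ a)
  have hr : (uliftEtSheaf X).map (Sigma.ι (freeZAffine X) k) ≫
      (uliftEtSheaf X).map (freeZAffineSumRetraction X k) = 𝟙 _ := by
    rw [← CategoryTheory.Functor.map_comp, ι_freeZAffineSumRetraction,
      CategoryTheory.Functor.map_id]
  have h' := (uliftEtSheaf X).map (Sigma.ι (freeZAffine X) k) ≫= h
  simp only [Category.assoc, reassoc_of% hr] at h'
  exact (cancel_epi _).1 h'

end Separator

/-! ### `ulift` preserves injectives -/

section Injective

variable (X : Scheme.{u})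

/-- `Shv(X_ét, Ab.{u+1})` is a Grothendieck abelian category (the site `X.Etale` is
`u+1`-small; as Mathlib's instance for `X.ProEt`). [folklore] -/
theorem isGrothendieckAbelian_etaleSheaf_ulift :
    IsGrothendieckAbelian.{u + 1} (Sheaf X.smallEtaleTopology AddCommGrpCat.{u + 1}) := by
  have : EssentiallySmall.{u + 1} X.Etale := inferInstance
  exact Sheaf.isGrothendieckAbelian_of_essentiallySmall X.smallEtaleTopology AddCommGrpCat.{u + 1}

attribute [local instance] isGrothendieckAbelian_etaleSheaf_ulift

/-- A subobject of `ulift G₀` is objectwise `u`-small. [folklore] -/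
theorem small_subobject_ulift (G₀ : Sheaf X.smallEtaleTopology AddCommGrpCat.{u})
    (A : Subobject ((uliftEtSheaf X).obj G₀)) (V : (X.Etale)ᵒᵖ) :
    Small.{u} ((A : Sheaf X.smallEtaleTopology AddCommGrpCat.{u + 1}).obj.obj V) := by
  haveI : Mono ((sheafToPresheaf _ _).map A.arrow) := inferInstance
  have hm : Mono (A.arrow.hom.app V) := inferInstance
  haveI : Small.{u} (((uliftEtSheaf X).obj G₀).obj.obj V) :=
    inferInstanceAs (Small.{u} (ULift.{u + 1} (G₀.obj.obj V)))
  exact small_of_injective ((AddCommGrpCat.mono_iff_injective _).1 hm)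

/-- **`ulift : Shv(X_ét, Ab.{u}) → Shv(X_ét, Ab.{u+1})` preserves injective objects.** By Baer's
criterion in the Grothendieck abelian category `Shv(X_ét, Ab.{u+1})` (Mathlib
`IsGrothendieckAbelian.generatingMonomorphisms_rlp`) it suffices to extend maps `A → ulift I`
along subobjects `A ↪ ulift G₀` of the separator; such an `A` is objectwise `u`-small, hence
`A ≅ ulift A₀` (`uliftShrinkEtSheafIso`), the inclusion and the map come from `Shv(X_ét, Ab.{u})`
(`ulift` is fully faithful), where `I` is injective. [folklore] -/
theorem hasLiftingProperty_subobject_arrow (I : Sheaf X.smallEtaleTopology AddCommGrpCat.{u})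
    [Injective I] (A : Subobject ((uliftEtSheaf X).obj (freeZAffineSum X))) :
    HasLiftingProperty A.arrow (0 : (uliftEtSheaf X).obj I ⟶ 0) := by
  haveI := small_subobject_ulift X (freeZAffineSum X) A
  -- `A ≅ ulift A₀`, the inclusion is `ulift` of a monomorphism `m₀ : A₀ → G₀`
  let e := uliftShrinkEtSheafIso X (A : Sheaf X.smallEtaleTopology AddCommGrpCat.{u + 1})
  let m₀ : shrinkEtSheaf X (A : Sheaf X.smallEtaleTopology AddCommGrpCat.{u + 1}) ⟶
      freeZAffineSum X := (uliftEtSheaf X).preimage (e.hom ≫ A.arrow)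
  have hm₀ : (uliftEtSheaf X).map m₀ = e.hom ≫ A.arrow := Functor.map_preimage _ _
  haveI : Mono m₀ := (uliftEtSheaf X).mono_of_mono_map (by rw [hm₀]; exact mono_comp _ _)
  refine ⟨fun {f g} sq => ?_⟩
  let f₀ : shrinkEtSheaf X (A : Sheaf X.smallEtaleTopology AddCommGrpCat.{u + 1}) ⟶ I :=
    (uliftEtSheaf X).preimage (e.hom ≫ f)
  obtain ⟨l₀, hl₀⟩ := Injective.factors f₀ m₀
  have fac : A.arrow ≫ (uliftEtSheaf X).map l₀ = f := by
    rw [← cancel_epi e.hom, ← Category.assoc, ← hm₀, ← CategoryTheory.Functor.map_comp, hl₀,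
      Functor.map_preimage]
  exact ⟨⟨⟨(uliftEtSheaf X).map l₀, fac, (isZero_zero _).eq_of_tgt _ _⟩⟩⟩

/-- **`ulift : Shv(X_ét, Ab.{u}) → Shv(X_ét, Ab.{u+1})` preserves injective objects.** By Baer's
criterion in the Grothendieck abelian category `Shv(X_ét, Ab.{u+1})` (Mathlib
`IsGrothendieckAbelian.generatingMonomorphisms_rlp`) it suffices to extend maps `A → ulift I`
along subobjects `A ↪ ulift G₀` of the separator; such an `A` is objectwise `u`-small, hence
`A ≅ ulift A₀` (`uliftShrinkEtSheafIso`), the inclusion and the map come from `Shv(X_ét, Ab.{u})`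
(`ulift` is fully faithful), where `I` is injective (`hasLiftingProperty_subobject_arrow`).
[folklore] -/
theorem injective_uliftEtSheaf_obj (I : Sheaf X.smallEtaleTopology AddCommGrpCat.{u})
    [Injective I] : Injective ((uliftEtSheaf X).obj I) := by
  rw [injective_iff_rlp_monomorphisms_zero,
    ← IsGrothendieckAbelian.generatingMonomorphisms_rlp (isSeparator_ulift_freeZAffineSum X)]
  intro A₁ B₁ i hi
  obtain ⟨A, hA⟩ := (MorphismProperty.ofHoms_iff _ _).1 hi
  haveI := hasLiftingProperty_subobject_arrow X I A
  exact HasLiftingProperty.of_arrow_iso_left (eqToIso hA.symm) 0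

end Injective

/-! ### Bhatt–Scholze Cor. 5.1.6 and Prop. 5.6.2 from the local claim alone -/

section Assembly

/-- **The acyclicity hypothesis `hc` of Cor. 5.1.6 from the printed local claim alone**
(`subsingleton_sheafH_etaleToProetPullbackULift_of_local` with `hL` discharged by
`injective_uliftEtSheaf_obj`). [cite: BhattScholze2015, Cor. 5.1.6 (proof)] -/
theorem subsingleton_sheafH_etaleToProetPullbackULift_of_local'
    (hloc : ∀ (X : Scheme.{u}) (I : Sheaf X.smallEtaleTopology AddCommGrpCat.{u}), Injective I →
      IsLocallyAcyclicOnAffineEtale X ((etaleToProetPullbackULift X).obj I))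
    (X : Scheme.{u}) (I : Sheaf X.smallEtaleTopology AddCommGrpCat.{u}) (hI : Injective I)
    (p : ℕ) : Subsingleton (((etaleToProetPullbackULift X).obj I).H (p + 1)) :=
  subsingleton_sheafH_etaleToProetPullbackULift_of_local
    (fun X I hI => haveI := hI; injective_uliftEtSheaf_obj X I) hloc X I hI p

/-- **Bhatt–Scholze Cor. 5.1.6 from the printed local claim alone.**
[cite: BhattScholze2015, Cor. 5.1.6] -/
theorem nonempty_addEquiv_sheafH_etaleToProetPullback_of_local'
    (hloc : ∀ (X : Scheme.{u}) (I : Sheaf X.smallEtaleTopology AddCommGrpCat.{u}), Injective I →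
      IsLocallyAcyclicOnAffineEtale X ((etaleToProetPullbackULift X).obj I)) :
    nonempty_addEquiv_sheafH_etaleToProetPullback.{u} :=
  nonempty_addEquiv_sheafH_etaleToProetPullback_of_local
    (fun X I hI => haveI := hI; injective_uliftEtSheaf_obj X I) hloc

/-- **The `lim¹` sequence `ellAdicCohomology_limOneSequence` (Bhatt–Scholze Prop. 5.6.2) from the
printed local claim of Cor. 5.1.6 alone.** [cite: BhattScholze2015, Prop. 5.6.2 and Cor. 5.1.6] -/
theorem ellAdicCohomology_limOneSequence_of_local'
    (hloc : ∀ (X : Scheme.{u}) (I : Sheaf X.smallEtaleTopology AddCommGrpCat.{u}), Injective I →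
      IsLocallyAcyclicOnAffineEtale X ((etaleToProetPullbackULift X).obj I)) :
    ellAdicCohomology_limOneSequence.{u} :=
  ellAdicCohomology_limOneSequence_of_local
    (fun X I hI => haveI := hI; injective_uliftEtSheaf_obj X I) hloc

end Assembly

end Literature.AlgebraicGeometry.Motives

end
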